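import Summits.CriticalPhenomena.SAWScalingLimit.Theorems.SAWLoopFugacityFlowIsingBoundaryRatioWindowRectStructure
import HarnessLib

/-!
# Window rectangle: cutting the boundary cycle into the four arcs
(line `fk-anchor-transfer`, crux `IsingBoundaryRatio`, stmt-CriticalPhenomena-10650; helper file of the stub
`windowRectPresentation_holds : WindowRectPresentation`)

In the static setting `X : WSetting`, from the skeleton `Q < P ≤ P' < R` of the boundary cycle
(`…WindowRectStructure`): the left arc is the descent `(Q, P)` or the ascent `(P', R)`, whichever is left, the
right arc is the other one, and the two remaining arcs are the low stretch `[P, P']` (all inner rim darts) and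
the high stretch `[R, Q + N]` (all outer rim darts). `isWindowRect_of_cut` checks the fields of `IsWindowRect`
from such cut data; `exists_isWindowRect` produces them. [folklore]
-/

noncomputable section

open scoped Classical Topology Real
open Filter Set Metric Complex
open Literature.Probability.LatticeModels Literature.Probability.RandomPlanarGeometry
open Literature.Probability.LatticeModels.DiscreteRect Literature.Topology.PlaneTopology
open UpperHalfPlane (upperHalfPlaneSet)

namespace Summit.CriticalPhenomena.SAWScalingLimit.Theorems.IsingBoundaryRatio

namespace WindowRect

namespace WSetting

variable (X : WSetting)

/-! ### Sides -/

/-- **The site of a left position is on the left rough side of the window.** [folklore] -/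
theorem annSide_of_lft {i : ℕ} (hi : i ∈ X.lft) : ∃ hx : X.site i ∈ X.Λ,
    (⟨X.site i, hx⟩ : ↥X.Λ) ∈ annSide X.D X.φ X.M X.ε X.δ X.ρ X.r₁ X.r₂ X.Λ true := by
  have hv := X.site_mem_verts i
  refine ⟨X.mem_Λ_of_mem_verts hv, X.mem_annWindow_of_mem_verts hv, ?_, ?_⟩
  · refine ⟨X.site_mem_meshDomain i, X.farSite i, ?_, hi.1⟩
    rw [farSite_def]; exact zdGraph_adj_add_dir _ _
  · have h := abs_le.1 (X.u_facts hi.1).2.2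
    have := X.u_le_of_lft hi
    obtain ⟨hm, hκ, hκm, hw₁, -⟩ := X.numer
    show (X.φ.symm (meshPoint X.δ (X.site i))).re < 0
    linarith [h.1]

/-- **The site of a right position is on the right rough side of the window.** [folklore] -/
theorem annSide_of_rgt {i : ℕ} (hi : i ∈ X.rgt) : ∃ hx : X.site i ∈ X.Λ,
    (⟨X.site i, hx⟩ : ↥X.Λ) ∈ annSide X.D X.φ X.M X.ε X.δ X.ρ X.r₁ X.r₂ X.Λ false := by
  have hv := X.site_mem_verts i
  refine ⟨X.mem_Λ_of_mem_verts hv, X.mem_annWindow_of_mem_verts hv, ?_, ?_⟩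
  · refine ⟨X.site_mem_meshDomain i, X.farSite i, ?_, hi.1⟩
    rw [farSite_def]; exact zdGraph_adj_add_dir _ _
  · have h := abs_le.1 (X.u_facts hi.1).2.2
    have := X.le_u_of_rgt hi
    obtain ⟨hm, hκ, hκm, hw₁, -⟩ := X.numer
    show 0 < (X.φ.symm (meshPoint X.δ (X.site i))).re
    linarith [h.2]

/-- A rough position with chart point of negative real part is left. [folklore] -/
theorem lft_of_re_neg {i : ℕ} (hi : i ∉ X.rim) (h : (X.φ.symm (meshPoint X.δ (X.site i))).re < 0) : i ∈ X.lft := by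
  rcases X.lft_or_rgt hi with h' | h'
  · exact h'
  · have h1 := abs_le.1 (X.u_facts hi).2.2
    have := X.le_u_of_rgt h'
    obtain ⟨hm, hκ, hκm, hw₁, -⟩ := X.numer
    linarith [h1.2]

/-- A rough position with chart point of positive real part is right. [folklore] -/
theorem rgt_of_re_pos {i : ℕ} (hi : i ∉ X.rim) (h : 0 < (X.φ.symm (meshPoint X.δ (X.site i))).re) : i ∈ X.rgt := by
  rcases X.lft_or_rgt hi with h' | h'
  · have h1 := abs_le.1 (X.u_facts hi).2.2
    have := X.u_le_of_lft h'
    obtain ⟨hm, hκ, hκm, hw₁, -⟩ := X.numer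
    linarith [h1.1]
  · exact h'

/-- **A boundary vertex of `E` of inner chart radius is the site of a deep rough position below `N`.**
[folklore] -/
theorem exists_pos_of_bdVerts {x : Site 2} (hx : x ∈ bdVerts X.E) (h1 : X.r₁' ≤ ‖X.φ.symm (meshPoint X.δ x)‖)
    (h2 : ‖X.φ.symm (meshPoint X.δ x)‖ ≤ X.r₂') :
    ∃ j, j < X.N ∧ X.site j = x ∧ j ∉ X.rim ∧ X.w₁ + 4 * X.m ≤ X.hgt j ∧ X.hgt j ≤ X.w₂ - 4 * X.m := by
  obtain ⟨k, hk⟩ := hx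
  obtain ⟨j, hjN, hj⟩ := X.cover hk
  have hs : X.site j = x := by rw [site_def, hj]
  have hh : X.hgt j = ‖X.φ.symm (meshPoint X.δ x)‖ := by rw [hgt_def, rad_def, hs]
  obtain ⟨-, -, h3, -, h5, -⟩ := X.radii
  have hκ := X.κ_le; have hm := X.hm
  refine ⟨j, hjN, hs, X.not_rim_of_mid (by rw [hh]; linarith) (by rw [hh]; linarith), by rw [hh]; linarith,
    by rw [hh]; linarith⟩

/-- Re-indexing from a new base: every position is a shift of the base by less than `N`. [folklore] -/
theorem exists_shift (B j : ℕ) : ∃ i, i < X.N ∧ X.dart (B + i) = X.dart j := by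
  have hN := X.N_spec.1
  have hB := Nat.mod_lt B hN
  refine ⟨(j + X.N - B % X.N) % X.N, Nat.mod_lt _ hN, ?_⟩
  rw [← X.dart_mod (B + _), ← X.dart_mod j]
  congr 1
  rw [Nat.add_mod, Nat.mod_mod, ← Nat.add_mod]
  have e : B + (j + X.N - B % X.N) = (j + X.N) + X.N * (B / X.N) := by
    have := Nat.div_add_mod B X.N; omega
  rw [e, Nat.add_mul_mod_self_left, Nat.add_mod_right]

/-! ### From cut data to the rectangle -/

/-- **`IsWindowRect` from cut data.** [folklore] -/
theorem isWindowRect_of_cut (B : ℕ) (n : Fin 4 → ℕ) (hpos : ∀ j, 0 < n j) (hsum : n 0 + n 1 + n 2 + n 3 = X.N)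
    (H0 : ∀ i, i < n 0 → B + i ∈ X.lft)
    (H2 : ∀ i, n 0 + n 1 ≤ i → i < n 0 + n 1 + n 2 → B + i ∈ X.rgt)
    (HL : ∀ j, j < X.N → j ∈ X.lft → X.w₁ + 4 * X.m ≤ X.hgt j → X.hgt j ≤ X.w₂ - 4 * X.m →
      ∃ i, i < n 0 ∧ X.dart (B + i) = X.dart j)
    (HR : ∀ j, j < X.N → j ∈ X.rgt → X.w₁ + 4 * X.m ≤ X.hgt j → X.hgt j ≤ X.w₂ - 4 * X.m →
      ∃ i, n 0 + n 1 ≤ i ∧ i < n 0 + n 1 + n 2 ∧ X.dart (B + i) = X.dart j)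
    (HI : ((∀ i, i < X.N → X.hgt (B + i) < X.w₁ + X.κ → n 0 ≤ i ∧ i < n 0 + n 1) ∧
           (∀ i, i < X.N → X.w₂ - X.κ < X.hgt (B + i) → n 0 + n 1 + n 2 ≤ i)) ∨
          ((∀ i, i < X.N → X.hgt (B + i) < X.w₁ + X.κ → n 0 + n 1 + n 2 ≤ i) ∧
           (∀ i, i < X.N → X.w₂ - X.κ < X.hgt (B + i) → n 0 ≤ i ∧ i < n 0 + n 1))) :
    IsWindowRect X.D X.φ X.M X.ε X.δ X.ρ X.r₁ X.r₂ X.r₁' X.r₂' X.Λ X.E (X.dart B) n := by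
  have l0 : lo n 0 = 0 := rfl
  have l1 : lo n 1 = n 0 := rfl
  have l2 : lo n 2 = n 0 + n 1 := rfl
  have l3 : lo n 3 = n 0 + n 1 + n 2 := rfl
  have hit : ∀ i, (succ X.E)^[i] (X.dart B) = X.dart (B + i) := fun i => (X.dart_add B i).symm
  obtain ⟨-, -, h3, h4, h5, -⟩ := X.radii
  have hκ := X.κ_le; have hm := X.hm
  refine ⟨⟨X.E_subset_zd, X.dart_ext B, hpos, ?_, ?_, ?_⟩, X.E_subset_edgeSet, X.mem_window, ?_, ?_, X.closed,
    X.bulk_mem, ?_, ?_, ?_⟩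
  · rw [hsum, hit, X.dart_add_N]
  · rw [hsum]; exact X.iterate_inj B
  · intro d hd
    obtain ⟨j, -, hj⟩ := X.cover hd
    obtain ⟨i, hi, hij⟩ := X.exists_shift B j
    exact ⟨i, by rw [hsum]; exact hi, by rw [hit, hij, hj]⟩
  · rintro x ⟨i, -, hi, rfl⟩
    rw [l0, zero_add] at hi
    rw [hit]; exact X.annSide_of_lft (H0 i hi)
  · rintro x ⟨i, hi1, hi2, rfl⟩
    rw [l2] at hi1 hi2
    rw [hit]; exact X.annSide_of_rgt (H2 i hi1 hi2)
  · intro x hx h1 h2 hre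
    obtain ⟨j, hjN, hjx, hjr, hd1, hd2⟩ := X.exists_pos_of_bdVerts hx h1 h2
    have hjL : j ∈ X.lft := X.lft_of_re_neg hjr (by rw [hjx]; exact hre)
    obtain ⟨i, hi, hij⟩ := HL j hjN hjL hd1 hd2
    exact ⟨i, by rw [l0]; exact Nat.zero_le i, by rw [l0, zero_add]; exact hi, by rw [hit, hij, ← hjx, site_def]⟩
  · intro x hx h1 h2 hre
    obtain ⟨j, hjN, hjx, hjr, hd1, hd2⟩ := X.exists_pos_of_bdVerts hx h1 h2
    have hjR : j ∈ X.rgt := X.rgt_of_re_pos hjr (by rw [hjx]; exact hre)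
    obtain ⟨i, hi1, hi2, hij⟩ := HR j hjN hjR hd1 hd2
    exact ⟨i, by rw [l2]; exact hi1, by rw [l2]; exact hi2, by rw [hit, hij, ← hjx, site_def]⟩
  · -- rim darts
    have key : ∀ i, (discreteDomainGraph X.D.carrier X.δ).Adj ((succ X.E)^[i] (X.dart B)).1
        (((succ X.E)^[i] (X.dart B)).1 + dir ((succ X.E)^[i] (X.dart B)).2) →
        (‖X.φ.symm (meshPoint X.δ ((succ X.E)^[i] (X.dart B)).1)‖ < X.r₁' → X.hgt (B + i) < X.w₁ + X.κ) ∧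
        (X.r₂' < ‖X.φ.symm (meshPoint X.δ ((succ X.E)^[i] (X.dart B)).1)‖ → X.w₂ - X.κ < X.hgt (B + i)) := by
      intro i hadj
      rw [hit] at hadj ⊢
      have hrim : B + i ∈ X.rim := hadj
      rw [← rad_def, ← site_def, ← hgt_def]
      rcases X.rim_cases hrim with h | h
      · have := X.hgt_lt_of_inner h
        exact ⟨fun _ => this, fun h' => by linarith⟩
      · have := X.lt_hgt_of_outer h
        exact ⟨fun h' => by linarith, fun _ => this⟩
    rw [hsum, l1, l3]
    rcases HI with ⟨hI, hO⟩ | ⟨hI, hO⟩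
    · left
      intro i hi hadj _
      obtain ⟨k1, k2⟩ := key i hadj
      exact ⟨fun h => hI i hi (k1 h), fun h => ⟨hO i hi (k2 h), by omega⟩⟩
    · right
      intro i hi hadj _
      obtain ⟨k1, k2⟩ := key i hadj
      exact ⟨fun h => ⟨hI i hi (k1 h), by omega⟩, fun h => hO i hi (k2 h)⟩

/-! ### The cut -/

/-- **The window edge set with its boundary cycle cut at the skeleton is a window rectangle.** [folklore] -/
theorem exists_isWindowRect : ∃ (d₀ : Site 2 × Fin 4) (n : Fin 4 → ℕ),
    IsWindowRect X.D X.φ X.M X.ε X.δ X.ρ X.r₁ X.r₂ X.r₁' X.r₂' X.Λ X.E d₀ n := by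
  obtain ⟨sk⟩ := X.exists_skel
  obtain ⟨Q, P, P', R, hQP, hPP', hP'R, hRN, hQ, hP, hP', hR, lowfree₁, highfree, lowfree₂, hands, deep⟩ := sk
  obtain ⟨hm, hκ, hκm, hw₁, hw₂⟩ := X.numer
  -- hands along the descent and the ascent
  have hrd : ∀ i, Q + 1 ≤ i → i ≤ P - 1 → i ∉ X.rim := fun i a b =>
    X.not_rim_of_mid (lowfree₁ i (by omega)) (highfree i (by omega) (by omega))
  have hru : ∀ i, P' + 1 ≤ i → i ≤ R - 1 → i ∉ X.rim := fun i a b =>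
    X.not_rim_of_mid (lowfree₂ i (by omega) (by omega)) (highfree i (by omega) (by omega))
  have hTd : ∀ i, Q + 1 ≤ i → i ≤ P - 1 → (i ∈ X.lft ↔ Q + 1 ∈ X.lft) := fun i a b =>
    X.lft_iff_of_interval hrd a b le_rfl (by omega)
  have hTu : ∀ i, P' + 1 ≤ i → i ≤ R - 1 → (i ∈ X.lft ↔ P' + 1 ∈ X.lft) := fun i a b =>
    X.lft_iff_of_interval hru a b le_rfl (by omega)
  have toR : ∀ i, i ∉ X.rim → i ∉ X.lft → i ∈ X.rgt := fun i hi hl => (X.lft_or_rgt hi).resolve_left hl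
  have notboth : ∀ i, i ∈ X.lft → i ∈ X.rgt → False := fun i h1 h2 => lt_asymm h1.2 h2.2
  -- low / high positions in a window of length `N`
  have lowpos : ∀ p, X.hgt p < X.w₁ + X.κ → p ≤ P' + X.N → (P ≤ p ∧ p ≤ P') ∨ (P + X.N ≤ p ∧ p ≤ P' + X.N) := by
    intro p hp hpb
    by_cases h1 : p < P
    · exact absurd hp (not_lt.2 (lowfree₁ p h1))
    by_cases h2 : p ≤ P'
    · exact Or.inl ⟨by omega, h2⟩
    by_cases h3 : p ≤ X.N
    · exact absurd hp (not_lt.2 (lowfree₂ p (by omega) h3))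
    · right
      have e : p = (p - X.N) + X.N := by omega
      rw [e, X.hgt_add_N] at hp
      by_cases h4 : p - X.N < P
      · exact absurd hp (not_lt.2 (lowfree₁ _ h4))
      · exact ⟨by omega, by omega⟩
  have highpos : ∀ p, X.w₂ - X.κ < X.hgt p → Q < p → p < R + X.N → R ≤ p ∧ p ≤ Q + X.N := by
    intro p hp h1 h2
    constructor
    · by_contra h; exact (not_lt.2 (highfree p h1 (by omega))) hp
    · by_contra h
      have e : p = (p - X.N) + X.N := by omega
      rw [e, X.hgt_add_N] at hp
      exact (not_lt.2 (highfree _ (by omega) (by omega))) hp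
  by_cases hA : Q + 1 ∈ X.lft
  · -- the descent is left: base `Q + 1`
    have hB : P' + 1 ∉ X.lft := fun h => hands (iff_of_true hA h)
    refine ⟨X.dart (Q + 1), ![P - Q - 1, P' - P + 1, R - P' - 1, Q + X.N + 1 - R], X.isWindowRect_of_cut _ _ ?_ ?_ ?_ ?_ ?_ ?_ ?_⟩
    · intro j; fin_cases j <;> simp <;> omega
    · simp; omega
    · intro i hi; simp at hi
      exact (hTd (Q + 1 + i) (by omega) (by omega)).2 hA
    · intro i h1 h2; simp at h1 h2
      exact toR _ (hru _ (by omega) (by omega)) fun h => hB ((hTu (Q + 1 + i) (by omega) (by omega)).1 h)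
    · intro j hjN hjL hd1 hd2
      rcases deep j hjN hd1 hd2 with ⟨a, b⟩ | ⟨a, b⟩
      · refine ⟨j - (Q + 1), by simp; omega, by congr 1; omega⟩
      · exact absurd ((hTu j (by omega) (by omega)).1 hjL) hB
    · intro j hjN hjR hd1 hd2
      rcases deep j hjN hd1 hd2 with ⟨a, b⟩ | ⟨a, b⟩
      · exact (notboth j ((hTd j (by omega) (by omega)).2 hA) hjR).elim
      · refine ⟨j - (Q + 1), by simp; omega, by simp; omega, by congr 1; omega⟩
    · left
      constructor
      · intro i hi hlow
        simp
        rcases lowpos (Q + 1 + i) hlow (by omega) with ⟨a, b⟩ | ⟨a, b⟩ <;> constructor <;> omega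
      · intro i hi hhigh
        simp
        have := highpos (Q + 1 + i) hhigh (by omega) (by omega)
        omega
  · -- the ascent is left: base `P' + 1`
    have hB : P' + 1 ∈ X.lft := by by_contra h; exact hands (iff_of_false hA h)
    have hA' : Q + 1 ∈ X.rgt := toR _ (hrd _ le_rfl (by omega)) hA
    refine ⟨X.dart (P' + 1), ![R - P' - 1, Q + X.N + 1 - R, P - Q - 1, P' - P + 1], X.isWindowRect_of_cut _ _ ?_ ?_ ?_ ?_ ?_ ?_ ?_⟩
    · intro j; fin_cases j <;> simp <;> omega
    · simp; omega
    · intro i hi; simp at hi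
      exact (hTu (P' + 1 + i) (by omega) (by omega)).2 hB
    · intro i h1 h2; simp at h1 h2
      have e : P' + 1 + i = (P' + 1 + i - X.N) + X.N := by omega
      rw [e, X.mem_rgt_add_N]
      exact toR _ (hrd _ (by omega) (by omega)) fun h => hA ((hTd _ (by omega) (by omega)).1 h)
    · intro j hjN hjL hd1 hd2
      rcases deep j hjN hd1 hd2 with ⟨a, b⟩ | ⟨a, b⟩
      · exact absurd ((hTd j (by omega) (by omega)).1 hjL) hA
      · refine ⟨j - (P' + 1), by simp; omega, by congr 1; omega⟩
    · intro j hjN hjR hd1 hd2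
      rcases deep j hjN hd1 hd2 with ⟨a, b⟩ | ⟨a, b⟩
      · refine ⟨j + X.N - (P' + 1), by simp; omega, by simp; omega, ?_⟩
        rw [show P' + 1 + (j + X.N - (P' + 1)) = j + X.N by omega, X.dart_add_N]
      · exact (notboth j ((hTu j (by omega) (by omega)).2 hB) hjR).elim
    · right
      constructor
      · intro i hi hlow
        simp
        rcases lowpos (P' + 1 + i) hlow (by omega) with ⟨a, b⟩ | ⟨a, b⟩ <;> omega
      · intro i hi hhigh
        simp
        by_cases hc : P' + 1 + i < R + X.N
        · have := highpos (P' + 1 + i) hhigh (by omega) hc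
          constructor <;> omega
        · -- `P' + 1 + i ≥ R + N` is impossible since `i < N` and … it is possible only if `P' + 1 ≥ R`: no
          omega

end WSetting

end WindowRect

/-- **The window edge set admits a rectangle presentation** in the static setting, closed form (registered
sub-goal of stmt-CriticalPhenomena-10650). [folklore] -/
theorem windowRect_exists_isWindowRect : ∀ (X : WindowRect.WSetting), ∃ (d₀ : Site 2 × Fin 4) (n : Fin 4 → ℕ), IsWindowRect X.D X.φ X.M X.ε X.δ X.ρ X.r₁ X.r₂ X.r₁' X.r₂' X.Λ X.E d₀ n :=
  fun X => X.exists_isWindowRect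

end Summit.CriticalPhenomena.SAWScalingLimit.Theorems.IsingBoundaryRatio

end
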